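import Literature.Probability.Percolation.AdjSpokeMeets
import Literature.Probability.Percolation.AdjDihedral
import Literature.Probability.Percolation.ArmSeparationExtSlotArith
import HarnessLib

/-!
# The thin spokes meet their ring tubes in the rotated and in the reflected readings

Topic `Literature/Probability/Percolation`; family `crit-perc` / near-critical percolation on `𝕋`.
A brick of the near-critical arm-separation theorem for four arms in the ADJACENT colour
arrangement (P. Nolin, EJP 13 (2008), Thm. 11, `j = 4`, `σ = BBWW` [arXiv 0711.4948: Thm. 10]),
landing step with a per-slot rotation (`AdjDihedral.lean`). The thin spoke
`adjSpoke aS c L ε = [aS, aS + L] × [c - ε, c + ε]` of a reading meets a tube of the thin ring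
`thinRing r e s` of the original frame (`n s = r`, lateral chunk `ι` of the centre row:
`-r + ι s ≤ c - ε`, `c + ε ≤ -r + (ι + 1) s`; `ε ≤ e`; `aS + s + 2ε + e ≤ r`; `r + e ≤ aS + L`):

* rotated readings `rotConfig a`: `adjSpokeMeetsRot_ringTube` — the entry tube
  `ringTube r e s (extPos n a ι)` as in the tree's `spokeMeetsRot_ringTube`;
* reflected readings `rswConfig a` (side `a + 2` read as side `0`): `adjSpokeMeetsRS_ringTube` —
  the entry tube `ringTube r e s (rswPos n a ι)`: the piece `H_{n-1-ι}` of the side `x₁ = r`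
  (`a = 0`), `-V_{n-1-ι}` (`a = 1`), the reflected vertical CONNECTOR `-stairV_{n-1-ι}` of the
  staircase (`a = 2`), `-H_{n-1-ι}` (`a = 3`), `V_{n-1-ι}` (`a = 4`), the connector
  `stairV_{n-1-ι}` (`a = 5`) (`ringTube_rswPos`).

Everything here is proved.

## References

* P. Nolin, Near-critical percolation in two dimensions, *Electron. J. Probab.* 13 (2008), §4.3
  Prop. 12 (proof) (arXiv 0711.4948: Prop. 11) [Nolin2008].
-/

noncomputable section

open Set

namespace Literature.Probability.Percolation

open LatticeModels Tube

/-! ### Rotated readings -/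

section Rot

variable {aS c : ℤ} {L ε r e s ι : ℕ}

/-- Frame `ρ⁰`: the thin spoke meets `V_ι`. [folklore] -/
theorem adjSpokeMeetsRot_zero (hι1 : -(r : ℤ) + ι * s ≤ c - ε) (hι2 : c + ε ≤ -(r : ℤ) + (ι + 1) * s)
    (ha : aS + s + 2 * ε + e ≤ r) (hb : (r : ℤ) + e ≤ aS + L) :
    SpokeMeetsRot 0 (adjSpoke aS c L ε) (vPiece r (-(r : ℤ)) e s ι) := by
  refine ⟨rfl, ?_, ?_, ?_, ?_⟩ <;>
    simp only [adjSpoke, vPiece, Nat.cast_add, Nat.cast_mul, Nat.cast_ofNat] <;> linarith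

/-- Frame `ρ¹`: the thin spoke meets the step `H_ι`. [folklore] -/
theorem adjSpokeMeetsRot_one (hι1 : -(r : ℤ) + ι * s ≤ c - ε) (hι2 : c + ε ≤ -(r : ℤ) + (ι + 1) * s)
    (ha : aS + s + 2 * ε + e ≤ r) (hb : (r : ℤ) + e ≤ aS + L) :
    SpokeMeetsRot 1 (adjSpoke aS c L ε) (stairH r e s ι) := by
  refine ⟨rfl, ?_, ?_, ?_, ?_⟩ <;>
    simp only [adjSpoke, stairH, Nat.cast_add, Nat.cast_mul, Nat.cast_ofNat] <;> linarith

/-- Frame `ρ²`: the thin spoke meets `H_ι` of the side `x₁ = r`. [folklore] -/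
theorem adjSpokeMeetsRot_two (hι1 : -(r : ℤ) + ι * s ≤ c - ε) (hι2 : c + ε ≤ -(r : ℤ) + (ι + 1) * s)
    (ha : aS + s + 2 * ε + e ≤ r) (hb : (r : ℤ) + e ≤ aS + L) :
    SpokeMeetsRot 2 (adjSpoke aS c L ε) (hPiece 0 r e s ι) := by
  refine ⟨rfl, ?_, ?_, ?_, ?_⟩ <;>
    simp only [adjSpoke, hPiece, Nat.cast_add, Nat.cast_mul, Nat.cast_ofNat] <;> linarith

/-- Frame `ρ³`: the thin spoke meets `-V_ι`. [folklore] -/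
theorem adjSpokeMeetsRot_three (hι1 : -(r : ℤ) + ι * s ≤ c - ε) (hι2 : c + ε ≤ -(r : ℤ) + (ι + 1) * s)
    (ha : aS + s + 2 * ε + e ≤ r) (hb : (r : ℤ) + e ≤ aS + L) :
    SpokeMeetsRot 3 (adjSpoke aS c L ε) (vPiece r (-(r : ℤ)) e s ι).neg := by
  refine ⟨rfl, ?_, ?_, ?_, ?_⟩ <;>
    simp only [adjSpoke, vPiece, Tube.neg, Nat.cast_add, Nat.cast_mul, Nat.cast_ofNat] <;> linarith

/-- Frame `ρ⁴`: the thin spoke meets `-H_ι`. [folklore] -/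
theorem adjSpokeMeetsRot_four (hι1 : -(r : ℤ) + ι * s ≤ c - ε) (hι2 : c + ε ≤ -(r : ℤ) + (ι + 1) * s)
    (ha : aS + s + 2 * ε + e ≤ r) (hb : (r : ℤ) + e ≤ aS + L) :
    SpokeMeetsRot 4 (adjSpoke aS c L ε) (stairH r e s ι).neg := by
  refine ⟨rfl, ?_, ?_, ?_, ?_⟩ <;>
    simp only [adjSpoke, stairH, Tube.neg, Nat.cast_add, Nat.cast_mul, Nat.cast_ofNat] <;> linarith

/-- Frame `ρ⁵`: the thin spoke meets `-H_ι` of the side `x₁ = r`. [folklore] -/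
theorem adjSpokeMeetsRot_five (hι1 : -(r : ℤ) + ι * s ≤ c - ε) (hι2 : c + ε ≤ -(r : ℤ) + (ι + 1) * s)
    (ha : aS + s + 2 * ε + e ≤ r) (hb : (r : ℤ) + e ≤ aS + L) :
    SpokeMeetsRot 5 (adjSpoke aS c L ε) (hPiece 0 r e s ι).neg := by
  refine ⟨rfl, ?_, ?_, ?_, ?_⟩ <;>
    simp only [adjSpoke, hPiece, Tube.neg, Nat.cast_add, Nat.cast_mul, Nat.cast_ofNat] <;> linarith

/-- **The thin spoke of the rotated reading `a` meets the entry tube `ringTube r e s (extPos n a ι)`.** [cite: Nolin2008, §4.3 Prop. 12 (proof) (arXiv 0711.4948: Prop. 11)] -/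
theorem adjSpokeMeetsRot_ringTube {a n : ℕ} (ha6 : a < 6) (hs : 1 ≤ s) (hns : n * s = r) (hn : 1 ≤ n) (hιn : ι < n)
    (hι1 : -(r : ℤ) + ι * s ≤ c - ε) (hι2 : c + ε ≤ -(r : ℤ) + (ι + 1) * s)
    (ha : aS + s + 2 * ε + e ≤ r) (hb : (r : ℤ) + e ≤ aS + L) :
    SpokeMeetsRot a (adjSpoke aS c L ε) (ringTube r e s (extPos n a ι)) := by
  have hn' : n = r / s := by rw [← hns, Nat.mul_div_cancel _ hs]
  subst hn'
  rw [ringTube_extPos hn ha6 hιn]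
  unfold pieceTube extIdx
  interval_cases a
  · exact adjSpokeMeetsRot_zero hι1 hι2 ha hb
  · exact adjSpokeMeetsRot_one hι1 hι2 ha hb
  · simp only [show (2 : ℕ) % 3 = 2 from rfl, if_true]
    rw [show r / s - 1 - (r / s - 1 - ι) = ι by omega]
    exact adjSpokeMeetsRot_two hι1 hι2 ha hb
  · exact adjSpokeMeetsRot_three hι1 hι2 ha hb
  · exact adjSpokeMeetsRot_four hι1 hι2 ha hb
  · simp only [show (5 : ℕ) % 3 = 2 from rfl, if_true]
    rw [show r / s - 1 - (r / s - 1 - ι) = ι by omega]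
    exact adjSpokeMeetsRot_five hι1 hι2 ha hb

end Rot

/-! ### Reflected readings -/

/-- **The position of the entry tube of the reflected reading `a`** (side `a + 2` read as side `0`),
`n` chunks per side, lateral chunk `ι` of the centre row. [folklore] -/
def rswPos (n a ι : ℕ) : ℕ :=
  match a with
  | 0 => 4 * n - 1 + 2 * (n - 1 - ι)
  | 1 => 6 * n - 2 + 2 * (n - 1 - ι)
  | 2 => 8 * n - 2 + 2 * (n - 1 - ι)
  | 3 => 10 * n - 3 + 2 * (n - 1 - ι)
  | 4 => 2 * (n - 1 - ι)
  | 5 => 2 * n + 2 * (n - 1 - ι)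
  | _ => 0

/-- **The entry tube of the reflected reading `a`.** [folklore] -/
def rswTube (r e s n a ι : ℕ) : Tube :=
  match a with
  | 0 => hPiece 0 r e s (n - 1 - ι)
  | 1 => (vPiece r (-(r : ℤ)) e s (n - 1 - ι)).neg
  | 2 => (stairV r e s (n - 1 - ι)).neg
  | 3 => (hPiece 0 r e s (n - 1 - ι)).neg
  | 4 => vPiece r (-(r : ℤ)) e s (n - 1 - ι)
  | 5 => stairV r e s (n - 1 - ι)
  | _ => vPiece r (-(r : ℤ)) e s 0

/-- `rswPos n a ι < 12 n - 4` (`1 ≤ n`, `a < 6`, `ι < n`). [folklore] -/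
theorem rswPos_lt {n a ι : ℕ} (hn : 1 ≤ n) (ha : a < 6) (hι : ι < n) : rswPos n a ι < 12 * n - 4 := by
  interval_cases a <;> simp only [rswPos] <;> omega

/-- Odd positions of the staircase block of the half ring are the vertical connectors. [folklore] -/
theorem halfTube_stairV {r e s j : ℕ} (hj : j < r / s) : halfTube r e s (2 * (r / s) + 2 * j) = stairV r e s j := by
  unfold halfTube
  rw [if_neg (by omega), if_pos (by omega), show 2 * (r / s) + 2 * j - (2 * (r / s) - 1) = 2 * j + 1 by omega, if_neg (by omega),
    show (2 * j + 1) / 2 = j by omega]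

/-- **The tube at the entry position of a reflected reading** (`1 ≤ n = r / s`, `a < 6`, `ι < n`). [folklore] -/
theorem ringTube_rswPos {r e s a ι : ℕ} (hr : 1 ≤ r / s) (ha : a < 6) (hι : ι < r / s) :
    ringTube r e s (rswPos (r / s) a ι) = rswTube r e s (r / s) a ι := by
  interval_cases a <;> simp only [rswPos, rswTube] <;> unfold ringTube
  · rw [if_pos (by omega), halfTube_hside (by omega)]
  · rw [if_neg (by omega), show 6 * (r / s) - 2 + 2 * (r / s - 1 - ι) - (6 * (r / s) - 2) = 2 * (r / s - 1 - ι) by omega,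
      halfTube_two_mul (by omega)]
  · rw [if_neg (by omega), show 8 * (r / s) - 2 + 2 * (r / s - 1 - ι) - (6 * (r / s) - 2) = 2 * (r / s) + 2 * (r / s - 1 - ι) by omega,
      halfTube_stairV (by omega)]
  · rw [if_neg (by omega), show 10 * (r / s) - 3 + 2 * (r / s - 1 - ι) - (6 * (r / s) - 2) = 4 * (r / s) - 1 + 2 * (r / s - 1 - ι) by omega,
      halfTube_hside (by omega)]
  · rw [if_pos (by omega), halfTube_two_mul (by omega)]
  · rw [if_pos (by omega), halfTube_stairV (by omega)]

/-- The entry tube of a reflected reading is a tube of the thin ring. [folklore] -/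
theorem rswTube_mem_thinRing {r e s a ι : ℕ} (hr : 1 ≤ r / s) (ha : a < 6) (hι : ι < r / s) :
    rswTube r e s (r / s) a ι ∈ thinRing r e s := by
  rw [← ringTube_rswPos hr ha hι]
  have hg := rswPos_lt hr ha hι
  unfold thinRing ringTube
  by_cases h : rswPos (r / s) a ι < 6 * (r / s) - 2
  · rw [if_pos h]
    refine List.mem_append_left _ ?_
    unfold thinHalfRing
    exact List.mem_iff_getElem?.2 ⟨_, getElem?_thinHalfRing hr h⟩
  · rw [if_neg h]
    refine List.mem_append_right _ (List.mem_map.2 ⟨_, ?_, rfl⟩)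
    unfold thinHalfRing
    exact List.mem_iff_getElem?.2 ⟨_, getElem?_thinHalfRing hr (by omega)⟩

section RS

variable {aS c : ℤ} {L ε r e s ι n : ℕ}

/-- Reading `σ` (`a = 0`): the thin spoke meets `H_{n-1-ι}` of the side `x₁ = r`. [folklore] -/
theorem adjSpokeMeetsRS_zero (hns : n * s = r) (hιn : ι < n)
    (hι1 : -(r : ℤ) + ι * s ≤ c - ε) (hι2 : c + ε ≤ -(r : ℤ) + (ι + 1) * s) (hεe : ε ≤ e)
    (ha : aS + s + 2 * ε + e ≤ r) (hb : (r : ℤ) + e ≤ aS + L) :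
    SpokeMeetsRS 0 (adjSpoke aS c L ε) (hPiece 0 r e s (n - 1 - ι)) := by
  have hns' : (n : ℤ) * s = r := by exact_mod_cast hns
  have hεe' : (ε : ℤ) ≤ e := by exact_mod_cast hεe
  have hcast : ((n - 1 - ι : ℕ) : ℤ) = n - 1 - ι := by omega
  refine ⟨rfl, ?_, ?_, ?_, ?_⟩ <;>
    simp only [adjSpoke, hPiece, hcast, Nat.cast_add, Nat.cast_mul, Nat.cast_ofNat] <;> nlinarith [hι1, hι2, hns']

/-- Reading `ρ ∘ σ` (`a = 1`): the thin spoke meets `-V_{n-1-ι}`. [folklore] -/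
theorem adjSpokeMeetsRS_one (hns : n * s = r) (hιn : ι < n)
    (hι1 : -(r : ℤ) + ι * s ≤ c - ε) (hι2 : c + ε ≤ -(r : ℤ) + (ι + 1) * s)
    (ha : aS + s + 2 * ε + e ≤ r) (hb : (r : ℤ) + e ≤ aS + L) :
    SpokeMeetsRS 1 (adjSpoke aS c L ε) (vPiece r (-(r : ℤ)) e s (n - 1 - ι)).neg := by
  have hns' : (n : ℤ) * s = r := by exact_mod_cast hns
  have hcast : ((n - 1 - ι : ℕ) : ℤ) = n - 1 - ι := by omega
  refine ⟨rfl, ?_, ?_, ?_, ?_⟩ <;>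
    simp only [adjSpoke, vPiece, Tube.neg, hcast, Nat.cast_add, Nat.cast_mul, Nat.cast_ofNat] <;> nlinarith [hι1, hι2, hns']

/-- Reading `ρ² ∘ σ` (`a = 2`): the thin spoke meets the reflected connector `-stairV_{n-1-ι}`. [folklore] -/
theorem adjSpokeMeetsRS_two (hns : n * s = r) (hιn : ι < n)
    (hι1 : -(r : ℤ) + ι * s ≤ c - ε) (hι2 : c + ε ≤ -(r : ℤ) + (ι + 1) * s) (hεe : ε ≤ e)
    (ha : aS + s + 2 * ε + e ≤ r) (hb : (r : ℤ) + e ≤ aS + L) :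
    SpokeMeetsRS 2 (adjSpoke aS c L ε) (stairV r e s (n - 1 - ι)).neg := by
  have hns' : (n : ℤ) * s = r := by exact_mod_cast hns
  have hεe' : (ε : ℤ) ≤ e := by exact_mod_cast hεe
  have hcast : ((n - 1 - ι : ℕ) : ℤ) = n - 1 - ι := by omega
  refine ⟨rfl, ?_, ?_, ?_, ?_⟩ <;>
    simp only [adjSpoke, stairV, Tube.neg, hcast, Nat.cast_add, Nat.cast_mul, Nat.cast_ofNat] <;> nlinarith [hι1, hι2, hns']

/-- Reading `-σ` (`a = 3`): the thin spoke meets `-H_{n-1-ι}`. [folklore] -/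
theorem adjSpokeMeetsRS_three (hns : n * s = r) (hιn : ι < n)
    (hι1 : -(r : ℤ) + ι * s ≤ c - ε) (hι2 : c + ε ≤ -(r : ℤ) + (ι + 1) * s) (hεe : ε ≤ e)
    (ha : aS + s + 2 * ε + e ≤ r) (hb : (r : ℤ) + e ≤ aS + L) :
    SpokeMeetsRS 3 (adjSpoke aS c L ε) (hPiece 0 r e s (n - 1 - ι)).neg := by
  have hns' : (n : ℤ) * s = r := by exact_mod_cast hns
  have hεe' : (ε : ℤ) ≤ e := by exact_mod_cast hεe
  have hcast : ((n - 1 - ι : ℕ) : ℤ) = n - 1 - ι := by omega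
  refine ⟨rfl, ?_, ?_, ?_, ?_⟩ <;>
    simp only [adjSpoke, hPiece, Tube.neg, hcast, Nat.cast_add, Nat.cast_mul, Nat.cast_ofNat] <;> nlinarith [hι1, hι2, hns']

/-- Reading `ρ⁴ ∘ σ` (`a = 4`): the thin spoke meets `V_{n-1-ι}`. [folklore] -/
theorem adjSpokeMeetsRS_four (hns : n * s = r) (hιn : ι < n)
    (hι1 : -(r : ℤ) + ι * s ≤ c - ε) (hι2 : c + ε ≤ -(r : ℤ) + (ι + 1) * s)
    (ha : aS + s + 2 * ε + e ≤ r) (hb : (r : ℤ) + e ≤ aS + L) :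
    SpokeMeetsRS 4 (adjSpoke aS c L ε) (vPiece r (-(r : ℤ)) e s (n - 1 - ι)) := by
  have hns' : (n : ℤ) * s = r := by exact_mod_cast hns
  have hcast : ((n - 1 - ι : ℕ) : ℤ) = n - 1 - ι := by omega
  refine ⟨rfl, ?_, ?_, ?_, ?_⟩ <;>
    simp only [adjSpoke, vPiece, hcast, Nat.cast_add, Nat.cast_mul, Nat.cast_ofNat] <;> nlinarith [hι1, hι2, hns']

/-- Reading `ρ⁵ ∘ σ` (`a = 5`): the thin spoke meets the connector `stairV_{n-1-ι}`. [folklore] -/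
theorem adjSpokeMeetsRS_five (hns : n * s = r) (hιn : ι < n)
    (hι1 : -(r : ℤ) + ι * s ≤ c - ε) (hι2 : c + ε ≤ -(r : ℤ) + (ι + 1) * s) (hεe : ε ≤ e)
    (ha : aS + s + 2 * ε + e ≤ r) (hb : (r : ℤ) + e ≤ aS + L) :
    SpokeMeetsRS 5 (adjSpoke aS c L ε) (stairV r e s (n - 1 - ι)) := by
  have hns' : (n : ℤ) * s = r := by exact_mod_cast hns
  have hεe' : (ε : ℤ) ≤ e := by exact_mod_cast hεe
  have hcast : ((n - 1 - ι : ℕ) : ℤ) = n - 1 - ι := by omega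
  refine ⟨rfl, ?_, ?_, ?_, ?_⟩ <;>
    simp only [adjSpoke, stairV, hcast, Nat.cast_add, Nat.cast_mul, Nat.cast_ofNat] <;> nlinarith [hι1, hι2, hns']

/-- **The thin spoke of the reflected reading `a` meets the entry tube `ringTube r e s (rswPos n a ι)`.** [cite: Nolin2008, §4.3 Prop. 12 (proof) (arXiv 0711.4948: Prop. 11)] -/
theorem adjSpokeMeetsRS_ringTube {a : ℕ} (ha6 : a < 6) (hs : 1 ≤ s) (hns : n * s = r) (hn : 1 ≤ n) (hιn : ι < n)
    (hι1 : -(r : ℤ) + ι * s ≤ c - ε) (hι2 : c + ε ≤ -(r : ℤ) + (ι + 1) * s) (hεe : ε ≤ e)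
    (ha : aS + s + 2 * ε + e ≤ r) (hb : (r : ℤ) + e ≤ aS + L) :
    SpokeMeetsRS a (adjSpoke aS c L ε) (ringTube r e s (rswPos n a ι)) := by
  have hn' : n = r / s := by rw [← hns, Nat.mul_div_cancel _ hs]
  have hns0 := hns
  subst hn'
  rw [ringTube_rswPos hn ha6 hιn]
  interval_cases a <;> simp only [rswTube]
  · exact adjSpokeMeetsRS_zero hns0 hιn hι1 hι2 hεe ha hb
  · exact adjSpokeMeetsRS_one hns0 hιn hι1 hι2 ha hb
  · exact adjSpokeMeetsRS_two hns0 hιn hι1 hι2 hεe ha hb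
  · exact adjSpokeMeetsRS_three hns0 hιn hι1 hι2 hεe ha hb
  · exact adjSpokeMeetsRS_four hns0 hιn hι1 hι2 ha hb
  · exact adjSpokeMeetsRS_five hns0 hιn hι1 hι2 hεe ha hb

end RS

end Literature.Probability.Percolation
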